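import Mathlib
import HarnessLib
import Summits.Ventures.LatticeQCDFlow.Exactness.LatticeCoordAvg

/-!
# LatticeQCDFlow / Scaling — the exact autoregressive context is invariant under coordinatewise
# measure-preserving reparametrisations of the single-site spaces

HONEST FRAMING: exact (Metropolis-corrected) sampling algorithms for lattice gauge theory;
figures of merit are autocorrelation/cost numbers at stated couplings and volumes; no
continuum-physics claim.

Venture `LatticeQCDFlow` (cell pub-lqcd), topic `Scaling`, FANOUT row 30 (lean-1, GEN-18) — OUR WORK,
bookkeeping for THEORY-2 §4 row C5 (what an exact autoregressive sampler must read).  The partial averages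
`A_s G = Exactness.coordAvg μ s G` (integrate the coordinates in `s` against the product reference measure,
keep the rest) and the exact conditionals `A_s G / A_{insert a s} G` are computed coordinate by coordinate,
so any COORDINATEWISE change of variables `Θ(ω)_i = θ_i(ω_i)` by measurable bijections `θ_i` of the
single-site space that preserve the reference measure `μ` commutes with them:

* §1 **`coordAvg_comp_coordMap`** — `A_s (G ∘ Θ) = (A_s G) ∘ Θ` (`θ_i : X ≃ᵐ X` measure preserving; any
  `G`, no measurability needed: `Θ` is a measurable equivalence of the product space preserving `⊗μ`,
  `MeasureTheory.measurePreserving_pi`); `arConditional_comp_coordMap` — the same for the conditionals.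
* §2 **`arConditional_reads_comp_coordMap_iff`** — for every coordinate `v`: the exact conditional of `a`
  for the weight `G ∘ Θ` READS `v` (two configurations agreeing off `v` with different conditionals) IF
  AND ONLY IF the one for `G` does; `arConditional_congr_on_comp_coordMap_iff` — likewise for "is
  determined by the coordinates in `T`"; `arConditional_readSet_comp_coordMap` — the read-sets coincide.
* §3 `measurePreserving_siteFlip`, `measurePreserving_neg_of_symmetric` — sublattice flips are
  admissible families.

READING (value-free): the read-set / receptive field of an exact autoregressive conditional is an
invariant of the weight's orbit under single-site symmetries of the reference measure.  USES: a
sublattice spin flip (`x ↦ −x` on `ℝ` with a symmetric reference measure, the swap on `{±1}`) maps an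
ANTIFERROMAGNET on a bipartite graph to a ferromagnet with the same read-sets, so the fill-neighbourhood
theorems of the strictly-TP₂ chain (`Scaling/AutoregressiveBlockFaithful`, `…ContextExact`) transfer
verbatim (instance not typed here); link-by-link translations in a gauge theory (cf.
`Scaling/AutoregressiveGaugeRedundancy.coordAvg_gaugeTransform`, the special case of a gauge
transformation).  NOT CLAIMED: non-bijective or non-measure-preserving maps; maps mixing coordinates.
Elementary over the parent; no `def`; nothing is cited as a fact; no `sorry`.
-/

noncomputable section

namespace Summit.Ventures.LatticeQCDFlow.Theory2.Autoregressive

open MeasureTheory Function Set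
open Summit.Ventures.LatticeQCDFlow.Exactness

variable {ι : Type*} [Fintype ι] [DecidableEq ι] {X : Type*} [MeasurableSpace X]
variable (μ : Measure X) [SigmaFinite μ]

/-! ## §1 Coordinate averages commute with coordinatewise measure-preserving bijections -/

omit [Fintype ι] [MeasurableSpace X] in
/-- Gluing commutes with a coordinatewise map. [ours] -/
theorem coordMap_piecewise (θ : ι → X → X) (s : Finset ι) (ω' ω : ι → X) :
    (fun i => θ i (s.piecewise ω' ω i)) = s.piecewise (fun i => θ i (ω' i)) (fun i => θ i (ω i)) := by
  funext i
  by_cases hi : i ∈ s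
  · simp [Finset.piecewise_eq_of_mem _ _ _ hi]
  · simp [Finset.piecewise_eq_of_notMem _ _ _ hi]

/-- **`A_s (G ∘ Θ) = (A_s G) ∘ Θ`** for a coordinatewise map `Θ(ω)_i = θ_i(ω_i)` by measurable
bijections `θ_i` preserving `μ` (no hypothesis on `G`). [ours] -/
theorem coordAvg_comp_coordMap (θ : ι → X ≃ᵐ X) (hθ : ∀ i, MeasurePreserving (θ i) μ μ)
    (s : Finset ι) (G : (ι → X) → ℝ) (ω : ι → X) :
    coordAvg μ s (fun η => G (fun i => θ i (η i))) ω = coordAvg μ s G (fun i => θ i (ω i)) := by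
  unfold coordAvg
  have hΘ : MeasurePreserving (MeasurableEquiv.piCongrRight θ) (Measure.pi fun _ : ι => μ)
      (Measure.pi fun _ : ι => μ) :=
    measurePreserving_pi (fun _ : ι => μ) (fun _ : ι => μ) hθ
  have hpt : ∀ ω' : ι → X, G (fun i => θ i (s.piecewise ω' ω i)) =
      (fun η : ι → X => G (s.piecewise η (fun i => θ i (ω i)))) (MeasurableEquiv.piCongrRight θ ω') := by
    intro ω'
    simp only [coordMap_piecewise]
    rfl
  calc ∫ ω', (fun η : ι → X => G (fun i => θ i (η i))) (s.piecewise ω' ω) ∂Measure.pi (fun _ : ι => μ)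
      = ∫ ω', (fun η : ι → X => G (s.piecewise η (fun i => θ i (ω i))))
          (MeasurableEquiv.piCongrRight θ ω') ∂Measure.pi (fun _ : ι => μ) :=
        integral_congr_ae (ae_of_all _ fun ω' => hpt ω')
    _ = ∫ η, G (s.piecewise η (fun i => θ i (ω i))) ∂Measure.pi (fun _ : ι => μ) :=
        hΘ.integral_comp' (fun η : ι → X => G (s.piecewise η (fun i => θ i (ω i))))

/-- The same for the exact autoregressive conditional `A_s G / A_{insert a s} G`. [ours] -/
theorem arConditional_comp_coordMap (θ : ι → X ≃ᵐ X) (hθ : ∀ i, MeasurePreserving (θ i) μ μ)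
    (s : Finset ι) (a : ι) (G : (ι → X) → ℝ) (ω : ι → X) :
    coordAvg μ s (fun η => G (fun i => θ i (η i))) ω /
        coordAvg μ (insert a s) (fun η => G (fun i => θ i (η i))) ω =
      coordAvg μ s G (fun i => θ i (ω i)) / coordAvg μ (insert a s) G (fun i => θ i (ω i)) := by
  rw [coordAvg_comp_coordMap μ θ hθ, coordAvg_comp_coordMap μ θ hθ]

/-! ## §2 Read-sets are invariant -/

omit [Fintype ι] [DecidableEq ι] [MeasurableSpace X] in
/-- Two configurations agree off `T` iff their images under a coordinatewise bijection do. [ours] -/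
theorem coordMap_agree_off_iff (θ : ι → X ≃ X) (T : Set ι) (ψ ψ' : ι → X) :
    (∀ i, i ∉ T → θ i (ψ i) = θ i (ψ' i)) ↔ ∀ i, i ∉ T → ψ i = ψ' i :=
  forall₂_congr fun i _ => (θ i).injective.eq_iff

/-- **THE EXACT CONDITIONAL OF `a` FOR `G ∘ Θ` READS `v` IFF THE ONE FOR `G` DOES** (`Θ` a
coordinatewise measure-preserving bijection): two configurations agreeing off `v` with different
conditionals exist for one weight iff they exist for the other. [ours] -/
theorem arConditional_reads_comp_coordMap_iff (θ : ι → X ≃ᵐ X) (hθ : ∀ i, MeasurePreserving (θ i) μ μ)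
    (s : Finset ι) (a v : ι) (G : (ι → X) → ℝ) :
    (∃ ψ ψ' : ι → X, (∀ i, i ≠ v → ψ i = ψ' i) ∧
      coordAvg μ s (fun η => G (fun i => θ i (η i))) ψ /
          coordAvg μ (insert a s) (fun η => G (fun i => θ i (η i))) ψ ≠
        coordAvg μ s (fun η => G (fun i => θ i (η i))) ψ' /
          coordAvg μ (insert a s) (fun η => G (fun i => θ i (η i))) ψ') ↔
    (∃ ψ ψ' : ι → X, (∀ i, i ≠ v → ψ i = ψ' i) ∧
      coordAvg μ s G ψ / coordAvg μ (insert a s) G ψ ≠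
        coordAvg μ s G ψ' / coordAvg μ (insert a s) G ψ') := by
  simp_rw [arConditional_comp_coordMap μ θ hθ]
  constructor
  · rintro ⟨ψ, ψ', hagree, hne⟩
    exact ⟨fun i => θ i (ψ i), fun i => θ i (ψ' i), fun i hi => by simp only [hagree i hi], hne⟩
  · rintro ⟨ψ, ψ', hagree, hne⟩
    refine ⟨fun i => (θ i).symm (ψ i), fun i => (θ i).symm (ψ' i), fun i hi => by simp only [hagree i hi],
      ?_⟩
    simpa only [MeasurableEquiv.apply_symm_apply] using hne

/-- **… AND IS DETERMINED BY THE COORDINATES IN `T` IFF THE ONE FOR `G` IS**: configurations agreeing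
on `T` have equal conditionals for `G ∘ Θ` iff they do for `G`. [ours] -/
theorem arConditional_congr_on_comp_coordMap_iff (θ : ι → X ≃ᵐ X)
    (hθ : ∀ i, MeasurePreserving (θ i) μ μ) (s : Finset ι) (a : ι) (T : Set ι) (G : (ι → X) → ℝ) :
    (∀ ψ ψ' : ι → X, (∀ i ∈ T, ψ i = ψ' i) →
      coordAvg μ s (fun η => G (fun i => θ i (η i))) ψ /
          coordAvg μ (insert a s) (fun η => G (fun i => θ i (η i))) ψ =
        coordAvg μ s (fun η => G (fun i => θ i (η i))) ψ' /
          coordAvg μ (insert a s) (fun η => G (fun i => θ i (η i))) ψ') ↔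
    (∀ ψ ψ' : ι → X, (∀ i ∈ T, ψ i = ψ' i) →
      coordAvg μ s G ψ / coordAvg μ (insert a s) G ψ = coordAvg μ s G ψ' / coordAvg μ (insert a s) G ψ') := by
  simp_rw [arConditional_comp_coordMap μ θ hθ]
  constructor
  · intro h ψ ψ' hagree
    have h' := h (fun i => (θ i).symm (ψ i)) (fun i => (θ i).symm (ψ' i)) fun i hi => by
      simp only [hagree i hi]
    simpa only [MeasurableEquiv.apply_symm_apply] using h'
  · intro h ψ ψ' hagree
    exact h _ _ fun i hi => by simp only [hagree i hi]

/-- **Read-SETS coincide**: `{v | the conditional of a for G ∘ Θ reads v} = {v | the one for G reads v}`.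
[ours] -/
theorem arConditional_readSet_comp_coordMap (θ : ι → X ≃ᵐ X) (hθ : ∀ i, MeasurePreserving (θ i) μ μ)
    (s : Finset ι) (a : ι) (G : (ι → X) → ℝ) :
    {v : ι | ∃ ψ ψ' : ι → X, (∀ i, i ≠ v → ψ i = ψ' i) ∧
      coordAvg μ s (fun η => G (fun i => θ i (η i))) ψ /
          coordAvg μ (insert a s) (fun η => G (fun i => θ i (η i))) ψ ≠
        coordAvg μ s (fun η => G (fun i => θ i (η i))) ψ' /
          coordAvg μ (insert a s) (fun η => G (fun i => θ i (η i))) ψ'} =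
    {v : ι | ∃ ψ ψ' : ι → X, (∀ i, i ≠ v → ψ i = ψ' i) ∧
      coordAvg μ s G ψ / coordAvg μ (insert a s) G ψ ≠
        coordAvg μ s G ψ' / coordAvg μ (insert a s) G ψ'} := by
  ext v
  exact arConditional_reads_comp_coordMap_iff μ θ hθ s a v G

/-! ## §3 Sublattice flips -/

omit [Fintype ι] [DecidableEq ι] [SigmaFinite μ] in
/-- **Sublattice flips are admissible**: flipping the coordinates of a set `B` by a measure-preserving
measurable bijection `τ` (and leaving the others alone) is a family of measure-preserving bijections,
so §1–§2 apply — e.g. `τ = (x ↦ −x)` for a symmetric reference measure on `ℝ`, turning an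
antiferromagnetic pair interaction across a bipartition into a ferromagnetic one. [ours] -/
theorem measurePreserving_siteFlip (τ : X ≃ᵐ X) (hτ : MeasurePreserving τ μ μ) (B : Set ι)
    [DecidablePred (· ∈ B)] (i : ι) :
    MeasurePreserving ((fun j => if j ∈ B then τ else MeasurableEquiv.refl X) i) μ μ := by
  by_cases hi : i ∈ B
  · simp only [hi, if_true]; exact hτ
  · simp only [hi, if_false]; exact MeasurePreserving.id μ

/-- The flip `x ↦ −x` of `ℝ` preserves every symmetric measure (`ν.map (x ↦ −x) = ν`). [ours] -/
theorem measurePreserving_neg_of_symmetric (ν : Measure ℝ) (hν : ν.map (fun x : ℝ => -x) = ν) :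
    MeasurePreserving (MeasurableEquiv.neg ℝ) ν ν :=
  ⟨(MeasurableEquiv.neg ℝ).measurable, hν⟩

end Summit.Ventures.LatticeQCDFlow.Theory2.Autoregressive

end
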